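import Summits.MatrixMultiplication.OmegaCensus.STPPTricoloredProduct
import Mathlib.Combinatorics.Additive.AP.Three.Behrend
import Mathlib.Data.Finset.Sort

/-!
# 3-AP-free sets of integers give `(2,2,2)^k` STPP families: the kernel form of `n_k ≤ k^{1+o(1)}`

Cell `pub-omega`, STPP track (family b′), seat pub-omega-stpp-2 (gen 6); item offered by the lead (gen 14, L15-1 OFFER).
HONEST FRAMING: lottery ticket; floor = certified bounds/negative ranges. Census STRUCTURE bookkeeping for question Q7 (the
onset `n_k` of `k` simultaneous-TPP triples of 2-subsets); a `(2,2,2)^k` family yields no matrix-multiplication bound of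
interest and nothing here is progress on `ω`.

* `isTricoloredSumFree_of_threeAPFree` — if `f : Fin k → ℕ` is injective with a 3-AP-free range (Mathlib `ThreeAPFree`) and
  `2 · f i < M` for all `i`, then `(f, f, −2f)` is a tricolored sum-free set in `ℤ/M` (no wrap-around:
  `|fᵢ + fⱼ − 2f_l| < M`).
* `exists_isSTPP_222pow_of_threeAPFree` — with the product law NR142 (`exists_isSTPP_222pow_mul_of_tsf`) and the seed
  `(2,2,2)¹ ⊆ (ℤ/2)³`: such an `f` gives `(2,2,2)^k ⊆ (ℤ/2)³ × ℤ/M` (order `8M`).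
* `exists_isSTPP_222pow_rothNumberNat` — taking a largest 3-AP-free subset of `{0, …, N−1}` (Mathlib `rothNumberNat_spec`):
  `(2,2,2)^{rothNumberNat N} ⊆ (ℤ/2)³ × ℤ/(2N)`, a group of order `16N`.  With Behrend's bound (Mathlib
  `Behrend.roth_lower_bound : N·exp(−4√(log N)) ≤ rothNumberNat N`) this is the finite form of `n_k ≤ k^{1+o(1)}`: for every
  `N`, `k = rothNumberNat N ≥ N e^{−4√log N}` triples fit in order `16N` (and every smaller `k` too, by dropping triples).
  The inversion to an explicit function of `k` is not carried out here; no lower bound is claimed.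

References: H. Cohn, R. Kleinberg, B. Szegedy, C. Umans, FOCS 2005 (arXiv:math/0511460), Def. 5.1; J. Blasiak et al., Discrete
Analysis 2017:3, Def. 3.1; F. Behrend, Proc. Nat. Acad. Sci. 32 (1946) 331–332 (via Mathlib).
-/

open Literature.Computability.AlgebraicComplexity Literature.Combinatorics.Additive Finset

namespace Summit.MatrixMultiplication.OmegaCensus

/-- **3-AP-free ⇒ tricolored sum-free.** An injective `f : Fin k → ℕ` whose range has no non-trivial 3-term arithmetic
progression and whose values satisfy `2·fᵢ < M` gives the tricolored sum-free set `(fᵢ, fⱼ, −2f_l)` in `ℤ/M`: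
`fᵢ + fⱼ − 2f_l ≡ 0 (mod M)` forces `fᵢ + fⱼ = 2f_l` in `ℕ` (the integer has absolute value `< M`), hence `fᵢ = f_l = fⱼ`.
[cite: BlasiakChurchCohnGrochowNaslundSawinUmans2017, Def. 3.1] -/
theorem isTricoloredSumFree_of_threeAPFree {k M : ℕ} (f : Fin k → ℕ) (hf : Function.Injective f)
    (hap : ThreeAPFree (Set.range f)) (hM : ∀ i, 2 * f i < M) :
    IsTricoloredSumFree (fun i => (f i : ZMod M)) (fun i => (f i : ZMod M)) (fun i => -(2 * (f i : ZMod M))) := by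
  intro i j l
  constructor
  · intro h0
    -- the integer `f i + f j - 2 f l` is divisible by `M` and has absolute value `< M`, hence vanishes
    have hz : ((f i + f j - 2 * f l : ℤ) : ZMod M) = 0 := by
      push_cast
      have : (f i : ZMod M) + f j - 2 * f l = (f i : ZMod M) + f j + -(2 * f l) := by ring
      rw [this]; exact h0
    have hdvd : (M : ℤ) ∣ (f i + f j - 2 * f l : ℤ) := (ZMod.intCast_zmod_eq_zero_iff_dvd _ _).1 hz
    have hi := hM i; have hj := hM j; have hl := hM l
    have habs : |(f i + f j - 2 * f l : ℤ)| < M := by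
      rw [abs_lt]; constructor <;> omega
    have h0z : (f i + f j - 2 * f l : ℤ) = 0 := Int.eq_zero_of_abs_lt_dvd hdvd habs
    have hsum : f i + f j = f l + f l := by omega
    have hil : f i = f l :=
      hap (Set.mem_range_self i) (Set.mem_range_self l) (Set.mem_range_self j) hsum
    have hjl : f j = f l := by omega
    exact ⟨hf (hil.trans hjl.symm), hf hjl⟩
  · rintro ⟨rfl, rfl⟩; ring

/-- **3-AP-free sets give `(2,2,2)^k` families**: with the product law `exists_isSTPP_222pow_mul_of_tsf` and the seed
`(2,2,2)¹ ⊆ (ℤ/2)³`, an injective 3-AP-free `f : Fin k → ℕ` with `2fᵢ < M` yields `k` simultaneous-TPP triples of 2-subsets in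
`(ℤ/2)³ × ℤ/M` (order `8M`). [cite: CohnKleinbergSzegedyUmans2005, Def. 5.1] -/
theorem exists_isSTPP_222pow_of_threeAPFree {k M : ℕ} (f : Fin k → ℕ) (hf : Function.Injective f)
    (hap : ThreeAPFree (Set.range f)) (hM : ∀ i, 2 * f i < M) :
    ∃ A B C : Fin (1 * k) → Finset ((ZMod 2 × ZMod 2 × ZMod 2) × ZMod M), IsSTPP A B C ∧
      ∀ m, (A m).card = 2 ∧ (B m).card = 2 ∧ (C m).card = 2 :=
  exists_isSTPP_222pow_mul_of_tsf exists_isSTPP_222pow1_seed_2_2_2 (isTricoloredSumFree_of_threeAPFree f hf hap hM)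

/-- **`(2,2,2)^{r(N)}` at order `16N`**, `r(N) = rothNumberNat N` the largest size of a 3-AP-free subset of `{0,…,N−1}`
(Mathlib): the onset of `k = rothNumberNat N` simultaneous-TPP triples of 2-subsets is at most `16N`.  With
`Behrend.roth_lower_bound` (`N e^{−4√log N} ≤ rothNumberNat N`) this is the finite form of `n_k ≤ k^{1+o(1)}` for STRUCTURE Q7.
[cite: CohnKleinbergSzegedyUmans2005, Def. 5.1] -/
theorem exists_isSTPP_222pow_rothNumberNat (N : ℕ) :
    ∃ A B C : Fin (1 * rothNumberNat N) → Finset ((ZMod 2 × ZMod 2 × ZMod 2) × ZMod (2 * N)), IsSTPP A B C ∧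
      ∀ m, (A m).card = 2 ∧ (B m).card = 2 ∧ (C m).card = 2 := by
  obtain ⟨t, ht, hcard, hap⟩ := rothNumberNat_spec N
  rw [← hcard]
  -- enumerate `t` increasingly
  let f : Fin t.card → ℕ := fun i => t.orderEmbOfFin rfl i
  have hf : Function.Injective f := (t.orderEmbOfFin rfl).injective
  have hmem : ∀ i, f i ∈ t := fun i => t.orderEmbOfFin_mem rfl i
  have hrange : Set.range f ⊆ (t : Set ℕ) := by rintro _ ⟨i, rfl⟩; exact hmem i
  have hM : ∀ i, 2 * f i < 2 * N := fun i => by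
    have := ht (hmem i); rw [mem_range] at this; omega
  exact exists_isSTPP_222pow_of_threeAPFree f hf (hap.mono hrange) hM

/-- The order of the host group in `exists_isSTPP_222pow_rothNumberNat` is `16N` (for `N ≥ 1`). -/
theorem card_host_rothNumberNat (N : ℕ) [NeZero N] :
    Fintype.card ((ZMod 2 × ZMod 2 × ZMod 2) × ZMod (2 * N)) = 16 * N := by
  simp only [Fintype.card_prod, ZMod.card]; ring


/-- **Behrend form of `n_k ≤ k^{1+o(1)}` (STRUCTURE Q7), gen-7 append.** For every `N` there is a `k` with
`N · e^{−4√(log N)} ≤ k` such that `k` simultaneous-TPP triples of 2-subsets exist in the abelian group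
`(ℤ/2)³ × ℤ/(2N)` of order `16N` (`card_host_rothNumberNat`): `k = rothNumberNat N` from
`exists_isSTPP_222pow_rothNumberNat`, bounded below by Mathlib's `Behrend.roth_lower_bound`.  No lower bound on the onset
is claimed. [cite: CohnKleinbergSzegedyUmans2005, Def. 5.1] -/
theorem exists_isSTPP_222pow_behrend (N : ℕ) :
    ∃ k : ℕ, (N : ℝ) * Real.exp (-4 * √(Real.log N)) ≤ k ∧
      ∃ A B C : Fin k → Finset ((ZMod 2 × ZMod 2 × ZMod 2) × ZMod (2 * N)), IsSTPP A B C ∧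
        ∀ m, (A m).card = 2 ∧ (B m).card = 2 ∧ (C m).card = 2 := by
  refine ⟨1 * rothNumberNat N, ?_, exists_isSTPP_222pow_rothNumberNat N⟩
  rw [one_mul]
  exact Behrend.roth_lower_bound

end Summit.MatrixMultiplication.OmegaCensus
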